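import Summits.BirchSwinnertonDyer.Rank1Residual.Iwasawa.InertiaCohomologyPTorsionFinite
import Literature.NumberTheory.EllipticCurves.SelmerProofs
import Literature.NumberTheory.EllipticCurves.SelmerCorankProofs
import HarnessLib

/-!
# `{x ∈ H¹(I_w(K_∞), M) : p·x = 0}` is finite at a place `w ∤ p` of a `ℤ_p`-extension, for a GENERIC
# `p`-divisible discrete module `M` with finite `p`-torsion of `p`-power order

Cell `bsd-eis` (home `run/shared/lean/pub/bsd-eis/`), seat `bsd-eis-k5-c2` g11, crux 2
`GoodLatticeBDPValue` (stmt-BirchSwinnertonDyer-19032), line `halves`, OPTION (B0): the port of b2b's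
`Iwasawa/InertiaCohomologyPTorsionFinite` (hard-wired to `E[p^∞]`) to a GENERIC discrete `Γ_K`-module
`M` — the local input for "the `p`-torsion of `H¹_{𝓕_nr^{S}}/H¹_{𝓕_nr}` is finite" for the character
modules `(F/𝒪)(θ)` of Keller–Yin §1.2 (which would turn the typed `S`-relaxation input
`prop125_residualPair_unrSelmer_quotient` into the bare corank identity).

HONEST FRAMING: tool theorems only (no definition, no named fact, no `sorry`); any number field, any
`ℤ_p`-extension, any discrete `Γ_K`-module with the displayed hypotheses; BSD is proved for no curve.

## What
For a number field `K`, a prime `p`, a discrete `Γ_K`-module `M` with open stabilisers (`hstab`),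
`p`-DIVISIBLE (`hdiv`), with FINITE `p`-torsion `M[p]` of `p`-power order (`hcard`):
* §1 `exists_torsionBy_lift` — Kummer: `H¹(H, M[p]) ↠ H¹(H, M)[p]` for every subgroup `H ≤ Γ_K`
  (port of `WeierstrassCurve.exists_torsionToPrimaryH1Sub_eq`).
* §2 `finite_discreteH1_inertia_torsionBy` — `H¹(I_v, M[p])` is finite for `v ∤ p` (Milne ADT I.2.9
  `#H¹(I_F, B) ≤ #B` via the tree's `natCard_continuousCohomology_one_absInertia_le`; port of
  `Iwasawa.finite_discreteH1_inertia_geomTorsion`).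
* §3 **`finite_setOf_nsmul_eq_zero_discreteH1_inertiaIn`** — `{x ∈ H¹(inertiaIn (ker κ) v, M) | p x = 0}`
  is finite for every `ℤ_p`-extension `κ` and `v ∤ p` (port of the b2b theorem of the same name).

References: Greenberg–Vatsal 2000 §2 pp. 17, 20; Milne ADT I Lemma 2.9; Greenberg LNM 1716 §5 p. 114.
-/

set_option linter.dupNamespace false
set_option autoImplicit false

noncomputable section

open scoped Classical AddSubgroup

open CategoryTheory NumberField IsDedekindDomain Field
open Summit.BirchSwinnertonDyer.Rank1Residual
open Literature.NumberTheory.EllipticCurves Literature.NumberTheory.EllipticCurves.GreenbergSelmer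
  Literature.NumberTheory.GaloisRepresentations

universe u

namespace Summit.BirchSwinnertonDyer.BirchSwinnertonDyer.Theorems.InertiaTorsionFiniteGeneric

/-! ## §1. Kummer: `H¹(H, M[p]) ↠ H¹(H, M)[p]` for a `p`-divisible discrete module -/

section Kummer

variable {K : Type u} [Field K] {M : Type u} [AddCommGroup M]
  [DistribMulAction (absoluteGaloisGroup K) M] [TopologicalSpace M] [DiscreteTopology M]
  (p : ℕ) (H : Subgroup (absoluteGaloisGroup K))

omit [DiscreteTopology M] in
/-- Orbit maps of `M` under a subgroup `H ≤ Γ_K` are continuous when stabilisers are open. [folklore] -/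
theorem continuous_smul_sub (hstab : ∀ m : M,
      IsOpen (MulAction.stabilizer (absoluteGaloisGroup K) m : Set (absoluteGaloisGroup K))) (b : M) :
    Continuous fun σ : H ↦ σ • b := by
  have : (fun σ : H ↦ σ • b) = (fun σ : absoluteGaloisGroup K ↦ σ • b) ∘ Subtype.val := by
    ext σ; rfl
  rw [this]
  exact (continuous_smul_of_isOpen_stabilizer b (hstab b)).comp continuous_subtype_val

/-- **Kummer lift at any subgroup: `H¹(H, M[p]) ↠ H¹(H, M)[p]`** for a `p`-DIVISIBLE discrete module
`M` with open stabilisers: if `p [φ] = 0` then `p φ = ∂a` with `a = p b`, and `φ - ∂b` takes values in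
`M[p]`. Port of `WeierstrassCurve.exists_torsionToPrimaryH1Sub_eq` (the case `M = E[p^∞]`).
Greenberg LNM 1716 §5 p. 114. [cite: GreenbergLNM1716, §5 p. 114] -/
theorem exists_torsionBy_lift [Fact p.Prime] (hdiv : ∀ m : M, ∃ m' : M, p • m' = m)
    (hstab : ∀ m : M,
      IsOpen (MulAction.stabilizer (absoluteGaloisGroup K) m : Set (absoluteGaloisGroup K)))
    {x : subgroupH1 H M} (hx : p • x = 0) :
    ∃ y : subgroupH1 H ↥(M[(p : ℤ)]),
      resH1Hom (ContinuousMonoidHom.id H) (M[(p : ℤ)]).subtype (fun _ _ ↦ rfl) y = x := by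
  obtain ⟨φ, rfl⟩ := oneCocycleClass_surjective _ x
  have h := oneCocycleClass_smul (discreteTopRep H M) (p : ℤ) φ
  conv at h => rhs; rw [Nat.cast_smul_eq_nsmul, hx]
  obtain ⟨a, ha⟩ := (oneCocycleClass_eq_zero_iff _ _).mp h
  have ha' : ∀ σ : H, p • φ.1 σ = σ • a - a := fun σ ↦ by
    rw [← natCast_zsmul]
    exact ha σ
  obtain ⟨b, rfl⟩ := hdiv a
  set φ' := φ - cobCocycle b (continuous_smul_sub H hstab b) with hφ'
  have hval : ∀ σ : H, p • φ'.1 σ = 0 := fun σ ↦ by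
    change p • (φ.1 σ - (σ • b - b)) = 0
    rw [smul_sub, ha', smul_sub, smul_comm, sub_self]
  have hmem : ∀ σ : H, φ'.1 σ ∈ M[(p : ℤ)] := fun σ ↦
    AddSubgroup.torsionBy.nsmul_iff.mpr (hval σ)
  let χ : contOneCocycles (discreteTopRep H ↥(M[(p : ℤ)])) :=
    contOneCocycles.lift (M[(p : ℤ)]).subtype (fun _ _ ↦ rfl) (M[(p : ℤ)]).subtype_injective φ'
      (fun σ ↦ ⟨_, hmem σ⟩) (fun _ ↦ rfl)
  refine ⟨oneCocycleClass _ χ, ?_⟩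
  rw [resH1Hom_id_oneCocycleClass, contOneCocycles.push_lift, hφ', oneCocycleClass_sub,
    oneCocycleClass_cobCocycle, sub_zero]

end Kummer

/-! ## §2. `H¹(I_v, M[p])` is finite for `v ∤ p` -/

section Local

variable {K : Type u} [Field K] [NumberField K] {M : Type u} [AddCommGroup M]
  [DistribMulAction (absoluteGaloisGroup K) M] [TopologicalSpace M] [DiscreteTopology M]
  (p : ℕ) (v : HeightOneSpectrum (𝓞 K))

/-- **`H¹(I_v, M[p])` is finite for `v ∤ p`**, for GreenbergSelmer's inertia group
`inertia v = res (absInertia K_v) ≤ Γ_K`, when `M[p]` is finite of `p`-power order and stabilisers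
are open: `M[p]` with the `Γ_{K_v}`-action through `absGaloisRestrict K K_v` is a `ContinuousRep` over
`ℤ` whose `TopRep` on `absInertia K_v` is the tree's `discreteTopRep`; `#M[p] = p^k` is prime to
`ringChar 𝓀[K_v] ≠ p`, so Milne ADT I.2.9 (`natCard_continuousCohomology_one_absInertia_le`) applies,
and inflation along `absInertia K_v ↠ inertia v` is injective. Port of
`Iwasawa.finite_discreteH1_inertia_geomTorsion`. [cite: MilneADT2006, I §2 Lemma 2.9] -/
theorem finite_discreteH1_inertia_torsionBy [Fact p.Prime] [Finite ↥(M[(p : ℤ)])]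
    (hcard : ∃ k : ℕ, Nat.card ↥(M[(p : ℤ)]) = p ^ k)
    (hstab : ∀ m : M,
      IsOpen (MulAction.stabilizer (absoluteGaloisGroup K) m : Set (absoluteGaloisGroup K)))
    (hpv : (p : 𝓞 K) ∉ v.asIdeal) :
    Finite (discreteH1 (inertia (K := K) v) ↥(M[(p : ℤ)])) := by
  have hp : (p : ℕ).Prime := Fact.out
  -- the local action (through the chosen embedding), as a local instance of this proof only
  letI : DistribMulAction (absoluteGaloisGroup (v.adicCompletion K)) ↥(M[(p : ℤ)]) :=
    DistribMulAction.compHom _ (absGaloisRestrict K (v.adicCompletion K)).toMonoidHom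
  have hcont : ∀ b : ↥(M[(p : ℤ)]), Continuous fun σ : absoluteGaloisGroup K ↦ σ • b := fun b ↦
    continuous_of_injective_comp (ι := ((↑) : ↥(M[(p : ℤ)]) → M)) Subtype.val_injective
      (by
        change Continuous fun σ : absoluteGaloisGroup K ↦ ((σ • b : ↥(M[(p : ℤ)])) : M)
        exact continuous_smul_of_isOpen_stabilizer (b : M) (hstab b))
  -- `M[p]` as a `ContinuousRep` of `Γ_{K_v}` over `ℤ`
  let ρ : ContinuousRep (absoluteGaloisGroup (v.adicCompletion K)) ℤ ↥(M[(p : ℤ)]) :=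
    { toRepresentation :=
        (discreteContRep (absoluteGaloisGroup (v.adicCompletion K)) ↥(M[(p : ℤ)])).toRepresentation
      continuous_smul := by
        refine continuous_prod_of_discrete_right.mpr fun b ↦ ?_
        change Continuous fun σ : absoluteGaloisGroup (v.adicCompletion K) ↦
          absGaloisRestrict K (v.adicCompletion K) σ • b
        exact (hcont b).comp (absGaloisRestrict K (v.adicCompletion K)).continuous_toFun }
  have hbridge : (ρ.restrict (Literature.NumberTheory.GaloisRepresentations.subgroupIncl
      (absInertia (v.adicCompletion K)))).toTopRep =
      discreteTopRep (absInertia (v.adicCompletion K)) ↥(M[(p : ℤ)]) :=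
    rfl
  -- `H¹(I_{K_v}, M[p])` is finite
  obtain ⟨k, hk⟩ := hcard
  have hℓ := ringChar_residueField_prime (F := v.adicCompletion K)
  have hne := v.ringChar_residueField_adicCompletion_ne hpv
  have hfin := (natCard_continuousCohomology_one_absInertia_le (v.adicCompletion K) ρ (by
      rw [hk]
      exact ((Nat.coprime_primes hp hℓ).2 (Ne.symm hne)).pow_left k)).1
  rw [hbridge] at hfin
  -- inflation along `absInertia K_v ↠ inertia v`
  let θ : absInertia (v.adicCompletion K) →ₜ* inertia (K := K) v :=
    { toFun := fun x ↦ ⟨absGaloisRestrict K (v.adicCompletion K) x, Subgroup.mem_map_of_mem _ x.2⟩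
      map_one' := Subtype.ext (by simp)
      map_mul' := fun x y ↦ Subtype.ext (by simp)
      continuous_toFun :=
        ((absGaloisRestrict K (v.adicCompletion K)).continuous_toFun.comp
          continuous_subtype_val).subtype_mk _ }
  have hθ : Function.Surjective θ := by
    rintro ⟨y, hy⟩
    obtain ⟨x, hx, rfl⟩ := Subgroup.mem_map.1 hy
    exact ⟨⟨x, hx⟩, rfl⟩
  exact Finite.of_injective _ (Iwasawa.resH1Hom_injective_of_surjective θ hθ fun _ _ ↦ rfl)

end Local

/-! ## §3. `{x ∈ H¹(inertiaIn H v, M) : p • x = 0}` is finite for `H = ker κ`, `v ∤ p` -/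

section Tower

variable {K : Type u} [Field K] [NumberField K] {M : Type u} [AddCommGroup M]
  [DistribMulAction (absoluteGaloisGroup K) M] [TopologicalSpace M] [DiscreteTopology M]
  {p : ℕ} [Fact p.Prime] (κ : ZpExtension K p) (v : HeightOneSpectrum (𝓞 K))

/-- **`{x ∈ H¹(inertiaIn H v, M) : p • x = 0}` is finite** for `H = ker κ`, ANY `ℤ_p`-extension `κ`
of the number field `K`, any `v ∤ p`, and any `p`-divisible discrete `Γ_K`-module `M` with open
stabilisers and finite `p`-torsion of `p`-power order — the `p`-torsion of Greenberg–Vatsal's local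
factor at the chosen place of `K_∞` above `v`. Chain (as in b2b's `E[p^∞]` file):
`H¹(inertiaIn H v, M) ↪ H¹(H ⊓ I_v, M)`, `H ⊓ I_v = I_v` (`inertia_le_kerSubgroup'`: `ℤ_p`-extensions are
unramified outside `p`), Kummer (§1) and `H¹(I_v, M[p])` finite (§2).
[cite: GreenbergVatsal2000, §2 pp. 17, 20] [cite: MilneADT2006, I §2 Lemma 2.9] -/
theorem finite_setOf_nsmul_eq_zero_discreteH1_inertiaIn [Finite ↥(M[(p : ℤ)])]
    (hcard : ∃ k : ℕ, Nat.card ↥(M[(p : ℤ)]) = p ^ k)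
    (hdiv : ∀ m : M, ∃ m' : M, p • m' = m)
    (hstab : ∀ m : M,
      IsOpen (MulAction.stabilizer (absoluteGaloisGroup K) m : Set (absoluteGaloisGroup K)))
    (hpv : (p : 𝓞 K) ∉ v.asIdeal) :
    Set.Finite {x : discreteH1 (inertiaIn κ.kerSubgroup v) M | p • x = 0} := by
  set H := κ.kerSubgroup with hH
  -- the three comparison maps
  obtain ⟨r₁, hr₁⟩ := Iwasawa.exists_injective_discreteH1_inertiaIn_to_inf (K := K) v H M
  have hle : inertia (K := K) v ≤ H ⊓ inertia (K := K) v :=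
    le_inf (Iwasawa.inertia_le_kerSubgroup' κ v hpv) le_rfl
  let r₂ : subgroupH1 (H ⊓ inertia (K := K) v) ↥(M[(p : ℤ)]) →+
      subgroupH1 (inertia (K := K) v) ↥(M[(p : ℤ)]) :=
    resOfLe (↥(M[(p : ℤ)])) hle
  have hr₂ : Function.Injective r₂ := by
    refine Function.LeftInverse.injective
      (g := resOfLe (↥(M[(p : ℤ)])) (inf_le_right : H ⊓ inertia (K := K) v ≤ _)) fun c ↦ ?_
    rw [← AddMonoidHom.comp_apply, resOfLe_comp_holds, resOfLe_refl_holds, AddMonoidHom.id_apply]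
  -- the finite source
  haveI := finite_discreteH1_inertia_torsionBy p v hcard hstab hpv
  haveI : Finite (subgroupH1 (H ⊓ inertia (K := K) v) ↥(M[(p : ℤ)])) := Finite.of_injective _ hr₂
  -- the `p`-torsion of `H¹(H ⊓ I_v, M)` is the image of `H¹(H ⊓ I_v, M[p])`
  have hT : Set.Finite {y : subgroupH1 (H ⊓ inertia (K := K) v) M | p • y = 0} := by
    refine ((Set.finite_univ (α := subgroupH1 (H ⊓ inertia (K := K) v) ↥(M[(p : ℤ)]))).image
      (resH1Hom (ContinuousMonoidHom.id _) (M[(p : ℤ)]).subtype (fun _ _ ↦ rfl))).subset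
      fun y hy ↦ ?_
    obtain ⟨z, hz⟩ := exists_torsionBy_lift p (H ⊓ inertia (K := K) v) hdiv hstab hy
    exact ⟨z, Set.mem_univ _, hz⟩
  -- pull back along the injection `r₁`
  refine (hT.preimage hr₁.injOn).subset fun x hx ↦ ?_
  show p • r₁ x = 0
  rw [← map_nsmul, (hx : p • x = 0), map_zero]

end Tower

end Summit.BirchSwinnertonDyer.BirchSwinnertonDyer.Theorems.InertiaTorsionFiniteGeneric

end
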